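/-
Copyright: the b2b-balaban T⁴-continuum CRUX team, row NE7b OWNER lineage `t4-ne7b-p1` (gen 119). Project licence.
-/
import Mathlib.Analysis.SpecialFunctions.Gaussian.GaussianIntegral
import Mathlib.MeasureTheory.Integral.Pi
import Summits.QuantumFields.BalabanUV.T4Continuum.Spine.NE7b.SupConvexClassEnvelope
import Summits.QuantumFields.BalabanUV.T4Continuum.Spine.NE7b.LogConcaveMarginalDeriv

/-!
# THE FLUCTUATION INTEGRAL OF A CLASS FUNCTION ALONG AN AFFINE FIBRE CHART: for `S` in (110)'s class (modulus `m > 0`) and ANY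
# injective linear chart `P` of the fluctuation directions (`p·Σ z² ≤ Σ(P z)²`), `Z(w) = ∫ e^{−S(M w + P z)} dz` converges and is
# positive at every base point; on the TWO-SIDED class the base derivative is dominated by ONE Gaussian over the unit ball of base
# points, and `w ↦ −log Z(w)` IS DIFFERENTIABLE EVERYWHERE with derivative the tilted mean of `(S′(M w + P z))∘M` — the measure-side
# twin of (110)'s envelope theorem, (28)'s dominated differentiation with every letter discharged
# (row NE7b, node U5c; (114) `…SupConvexClassEnvelope` + (28) LCMD BY NAME; [folklore])

Cell `pub-balaban`, sub-cell `t4`, spine estimate NE7b (`T4WeightBudget.RelWeightBound`; the cell's OWN estimate — NOT PRINTED in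
[Bałaban 1983–89], NOT PROVED).  Crux-route work under `Spine/NE7b/` by the row OWNER (`t4-ne7b-p1` gen 119) under FREEZE (0)'s
crux-prover clause, on the OWNER g118's located NEXT item (3)(c) «the measure side: junction of the abstract class with (26)∕(31)»;
NOTHING of Bałaban's is named as a Lean object, valued or asserted; no `T4Continuum/Support` leaf typed; no `def`, no notation;
zero `sorry`.  Imports (BY NAME): the OWNER's (114) `…SupConvexClassEnvelope` (`continuous_of_hasFDerivAt`, `continuous_gradient`,
`exp_neg_le_gaussian`, `sum_sq_le_card_mul_norm_sq`, `weighted_envelope`), the OWNER's (28) `…LogConcaveMarginalDeriv`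
(`hasFDerivAt_neg_log_fibreIntegral`), Mathlib's Gaussian integral and `MeasureTheory.Integral.Pi`.

WHY (located).  The true renormalisation step integrates the fibre `{Qt ψ = w} = M w + ker Qt` of a block map; reading `ker Qt`
through a linear chart `P : ℝ^σ → ℝ^ι` (injective; `Qt∘P = 0` is only needed by the sequel's Brascamp–Lieb letter) the integrated
effective action is `W_int(w) = −log ∫_{ℝ^σ} e^{−S(M w + P z)} dz` with the product Lebesgue measure on `σ → ℝ` — no measure on a
subspace is named.  Convergence and positivity are (114)'s Gaussian envelope (`Σ(P z)² ≥ p·Σ z²` makes it a product Gaussian in `z`);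
differentiability is (28) once the base derivative `e^{−S(M w + P z)}·‖(S′(M w + P z))∘M‖` is dominated by an integrable function
of `z` uniformly for `w` in a ball — (114)'s weighted envelope about `M w₀` and `Σ(M w + P z − M w₀)² ≥ (p∕2)Σ z² − |ι|‖M‖²‖w − w₀‖²`.

WHAT IS PROVED ([folklore]; finite carriers `ι, κ, σ`; `M : ℝ^κ → ℝ^ι`, `P : ℝ^σ → ℝ^ι` continuous linear, `p·Σ z² ≤ Σ(P z)²`):
* §1 `sum_sq_chart_lower`, `integrable_gaussian_pi` (`C·e^{−aΣ z_i²}` is integrable on `σ → ℝ`, `a > 0`),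
  `continuous_gradient_comp_chart`, **`integrable_exp_neg_chart`** (class, `m > 0`, `p > 0`: `z ↦ e^{−S(M w + P z)}` integrable), **`fibreIntegral_pos`** (`0 < Z(w)`),
  **`chart_domination`** (two-sided class: for `‖w − w₀‖ ≤ 1` and all `z`,
  `e^{−S(M w + P z)}‖(S′(M w + P z))∘M‖ ≤ K·e^{−(mp∕16)Σ z²}`, `K` explicit in `S(M w₀)`, `‖S′(M w₀)‖`, `m`, `Λ`, `|ι|`, `‖M‖`),
  **`hasFDerivAt_neg_log_fibreIntegral_chart`** (THE END: at EVERY `w₀`,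
  `HasFDerivAt (w ↦ −log ∫ e^{−S(M w + P z)} dz) (Z(w₀)⁻¹ • ∫ e^{−S(M w₀ + P z)} • (S′(M w₀ + P z))∘M dz) w₀`),
  `integrable_weighted_gradient_chart` (the CLM-valued integrand is Bochner integrable, so the derivative applied to `k` is the
  tilted mean of `S′(M w₀ + P z)(M k)` by `ContinuousLinearMap.integral_apply`).
* §2 toy.

HONEST (what this is NOT).  One dominated-convergence call on (114)'s envelopes; no first-order letter for `W_int` (the sequel
`…SupConvexStepIntegrated`: Brascamp–Lieb), no locality, no constants beyond the displayed `K`; the two-sided class is an honest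
restriction (`φ⁴` excluded); nothing about which chart print uses; cubic periods; scalar skeleton ((A3), NC-NE7b-α UNRULED); nothing
of Bałaban's.  BY-NAME EFFECT ON THE WALL: NONE.  NE7b NOT PRINTED ∕ NOT PROVED; spine PROVED 0∕9; rung (B)+1 on a FINITE torus — NOT
infinite volume, NOT the mass gap, NOT Clay.  HONEST DEPENDENCY: continuum YM on T⁴ ⇐ BetaPertH ∧ nine spine estimates (0∕9 proved);
BetaPertH ⇐ (D1) ∧ (D4) ∧ CAP+tail; G-an2-4 gates asym, D1 and NE2∕3∕4.
-/

set_option autoImplicit false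

noncomputable section

namespace Summit.QuantumFields.BalabanUV.T4Continuum.NE7b.SupConvexFibreIntegral

open Set Function Filter Metric MeasureTheory Real
open scoped Topology
open SupConvexClassEnvelope (continuous_of_hasFDerivAt continuous_gradient exp_neg_le_gaussian sum_sq_le_card_mul_norm_sq
  weighted_envelope)
open LogConcaveMarginalDeriv (hasFDerivAt_neg_log_fibreIntegral)

/-! ## §1. Along an affine fibre chart `ψ = M w + P z` -/

section Chart

variable {ι κ σ : Type*} [Fintype ι] [Fintype κ] [Fintype σ]
  {S : (ι → ℝ) → ℝ} {S' : (ι → ℝ) → (ι → ℝ) →L[ℝ] ℝ} {m Λ p : ℝ}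
  (M : (κ → ℝ) →L[ℝ] (ι → ℝ)) (P : (σ → ℝ) →L[ℝ] (ι → ℝ))

/-- `Σ(M(w − w₀) + P z)²`-type lower bound: `(u + v)² ≥ ½u² − v²` summed, with `Σ(P z)² ≥ p·Σ z²` and
`Σ(M k)² ≤ |ι|‖M‖²‖k‖²`: `(p∕2)Σ z² − |ι|‖M‖²‖w − w₀‖² ≤ Σ(M w + P z − M w₀)²`. [folklore] -/
theorem sum_sq_chart_lower (hP : ∀ z : σ → ℝ, p * ∑ i, z i ^ 2 ≤ ∑ x, P z x ^ 2) (w w₀ : κ → ℝ) (z : σ → ℝ) :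
    p / 2 * ∑ i, z i ^ 2 - Fintype.card ι * ‖M‖ ^ 2 * ‖w - w₀‖ ^ 2 ≤ ∑ x, ((M w + P z) x - M w₀ x) ^ 2 := by
  have hpt : ∀ x, (P z x) ^ 2 / 2 - (M (w - w₀) x) ^ 2 ≤ ((M w + P z) x - M w₀ x) ^ 2 := fun x => by
    have e : (M w + P z) x - M w₀ x = P z x + M (w - w₀) x := by
      simp only [Pi.add_apply, map_sub, Pi.sub_apply]; ring
    rw [e]
    nlinarith [sq_nonneg (P z x / 2 + M (w - w₀) x), sq_nonneg (P z x + 2 * M (w - w₀) x)]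
  have hM : ∑ x, (M (w - w₀) x) ^ 2 ≤ Fintype.card ι * ‖M‖ ^ 2 * ‖w - w₀‖ ^ 2 := by
    have h1 := sum_sq_le_card_mul_norm_sq (M (w - w₀))
    have h2 : ‖M (w - w₀)‖ ^ 2 ≤ (‖M‖ * ‖w - w₀‖) ^ 2 :=
      pow_le_pow_left₀ (norm_nonneg _) (M.le_opNorm _) 2
    calc ∑ x, (M (w - w₀) x) ^ 2 ≤ Fintype.card ι * ‖M (w - w₀)‖ ^ 2 := h1
      _ ≤ Fintype.card ι * (‖M‖ * ‖w - w₀‖) ^ 2 := mul_le_mul_of_nonneg_left h2 (Nat.cast_nonneg _)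
      _ = Fintype.card ι * ‖M‖ ^ 2 * ‖w - w₀‖ ^ 2 := by ring
  have hsum := Finset.sum_le_sum fun x (_ : x ∈ Finset.univ) => hpt x
  rw [Finset.sum_sub_distrib, ← Finset.sum_div] at hsum
  have := hP z
  linarith

omit [Fintype ι] in
/-- **A PRODUCT GAUSSIAN IS INTEGRABLE ON A FINITE CARRIER** (`a > 0`): `z ↦ C·e^{−a·Σ z_i²}` is integrable for the product
Lebesgue measure on `σ → ℝ`. [folklore] -/
theorem integrable_gaussian_pi {a : ℝ} (ha : 0 < a) (C : ℝ) :
    Integrable (fun z : σ → ℝ => C * exp (-a * ∑ i, z i ^ 2)) := by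
  have hprod : Integrable (fun z : σ → ℝ => ∏ i, exp (-a * z i ^ 2)) := by
    have := Integrable.fintype_prod (ι := σ) (f := fun (_ : σ) (t : ℝ) => exp (-a * t ^ 2)) (μ := fun _ => volume)
      fun _ => integrable_exp_neg_mul_sq ha
    rw [← volume_pi] at this
    exact this
  refine (hprod.const_mul C).congr (Eventually.of_forall fun z => ?_)
  simp only
  rw [Finset.mul_sum, Real.exp_sum]

omit [Fintype σ] in
/-- **THE BASE DERIVATIVE ALONG THE CHART IS CONTINUOUS IN THE FLUCTUATION VARIABLE**: `z ↦ (S′(M w + P z))∘M` is continuous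
((114)'s `continuous_gradient` and continuity of `L ↦ L∘M`). [folklore] -/
theorem continuous_gradient_comp_chart (hS : ∀ φ, HasFDerivAt S (S' φ) φ)
    (hconv : ∀ φ ψ : ι → ℝ, S φ + S' φ (ψ - φ) ≤ S ψ) (w : κ → ℝ) :
    Continuous fun z : σ → ℝ => (S' (M w + P z)).comp M := by
  have hgrad : Continuous S' := continuous_gradient hS hconv
  have hcompM : Continuous fun L : (ι → ℝ) →L[ℝ] ℝ => L.comp M := by
    have : (fun L : (ι → ℝ) →L[ℝ] ℝ => L.comp M) =
        fun L => (ContinuousLinearMap.compL ℝ (κ → ℝ) (ι → ℝ) ℝ).flip M L := by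
      funext L; rw [ContinuousLinearMap.flip_apply, ContinuousLinearMap.compL_apply]
    rw [this]; exact ContinuousLinearMap.continuous _
  exact hcompM.comp (hgrad.comp ((continuous_const (y := M w)).add P.continuous))

omit [Fintype κ] in
/-- **THE FIBRE DENSITY ALONG THE CHART IS INTEGRABLE** (`m > 0`, `p·Σ z² ≤ Σ(P z)²`, `p > 0`): `z ↦ e^{−S(M w + P z)}` is integrable
on `σ → ℝ`. [folklore] -/
theorem integrable_exp_neg_chart (hS : ∀ φ, HasFDerivAt S (S' φ) φ)
    (hlo : ∀ φ ψ : ι → ℝ, S φ + S' φ (ψ - φ) + m / 2 * ∑ x, (ψ x - φ x) ^ 2 ≤ S ψ) (hm : 0 < m)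
    (hP : ∀ z : σ → ℝ, p * ∑ i, z i ^ 2 ≤ ∑ x, P z x ^ 2) (hp : 0 < p) (w : κ → ℝ) :
    Integrable (fun z : σ → ℝ => exp (-S (M w + P z))) := by
  have hcont : Continuous S := continuous_of_hasFDerivAt hS
  have hVc : Continuous fun z : σ → ℝ => S (M w + P z) := hcont.comp ((continuous_const (y := M w)).add P.continuous)
  have hmeas : AEStronglyMeasurable (fun z : σ → ℝ => exp (-S (M w + P z))) volume :=
    (continuous_exp.comp hVc.neg).aestronglyMeasurable
  refine Integrable.mono' (integrable_gaussian_pi (a := m * p / 4) (by positivity) (exp (-S (M w) + ‖S' (M w)‖ ^ 2 / m)))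
    hmeas (Eventually.of_forall fun z => ?_)
  rw [Real.norm_eq_abs, abs_of_pos (exp_pos _)]
  refine (exp_neg_le_gaussian hlo hm (M w) (M w + P z)).trans ?_
  refine mul_le_mul_of_nonneg_left (exp_le_exp.2 ?_) (exp_pos _).le
  have e : ∑ x, ((M w + P z) x - M w x) ^ 2 = ∑ x, P z x ^ 2 := Finset.sum_congr rfl fun x _ => by
    simp only [Pi.add_apply, add_sub_cancel_left]
  rw [e]
  have := hP z
  nlinarith

omit [Fintype κ] in
/-- **THE FIBRE INTEGRAL IS POSITIVE**: `0 < Z(w) = ∫ e^{−S(M w + P z)} dz`. [folklore] -/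
theorem fibreIntegral_pos (hS : ∀ φ, HasFDerivAt S (S' φ) φ)
    (hlo : ∀ φ ψ : ι → ℝ, S φ + S' φ (ψ - φ) + m / 2 * ∑ x, (ψ x - φ x) ^ 2 ≤ S ψ) (hm : 0 < m)
    (hP : ∀ z : σ → ℝ, p * ∑ i, z i ^ 2 ≤ ∑ x, P z x ^ 2) (hp : 0 < p) (w : κ → ℝ) :
    0 < ∫ z : σ → ℝ, exp (-S (M w + P z)) :=
  integral_exp_pos (integrable_exp_neg_chart M P hS hlo hm hP hp w)

/-- **DOMINATION OF THE BASE DERIVATIVE BY ONE GAUSSIAN OVER THE UNIT BALL OF BASE POINTS** (two-sided class): for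
`‖w − w₀‖ ≤ 1` and every `z`, `e^{−S(M w + P z)}·‖(S′(M w + P z))∘M‖ ≤ K·e^{−(mp∕16)Σ z²}` with
`K = K(M w₀)·‖M‖·e^{(m∕8)|ι|‖M‖²}`. [folklore] -/
theorem chart_domination (hlo : ∀ φ ψ : ι → ℝ, S φ + S' φ (ψ - φ) + m / 2 * ∑ x, (ψ x - φ x) ^ 2 ≤ S ψ) (hm : 0 < m)
    (hup : ∀ φ ψ : ι → ℝ, S ψ ≤ S φ + S' φ (ψ - φ) + Λ / 2 * ∑ x, (ψ x - φ x) ^ 2) (hΛ : 0 ≤ Λ)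
    (hP : ∀ z : σ → ℝ, p * ∑ i, z i ^ 2 ≤ ∑ x, P z x ^ 2) (w₀ : κ → ℝ) {w : κ → ℝ} (hw : ‖w - w₀‖ ≤ 1)
    (z : σ → ℝ) :
    exp (-S (M w + P z)) * ‖(S' (M w + P z)).comp M‖ ≤
      exp (-S (M w₀) + ‖S' (M w₀)‖ ^ 2 / m) * (‖S' (M w₀)‖ + Λ * Fintype.card ι + 8 * Λ / m) * ‖M‖ *
        exp (m / 8 * (Fintype.card ι * ‖M‖ ^ 2)) * exp (-(m * p / 16) * ∑ i, z i ^ 2) := by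
  set K0 : ℝ := exp (-S (M w₀) + ‖S' (M w₀)‖ ^ 2 / m) * (‖S' (M w₀)‖ + Λ * Fintype.card ι + 8 * Λ / m) with hK0
  have hK0nn : 0 ≤ K0 := mul_nonneg (exp_pos _).le (by positivity)
  have hwe := weighted_envelope hlo hm hup hΛ (M w₀) (M w + P z)
  have hcomp : ‖(S' (M w + P z)).comp M‖ ≤ ‖S' (M w + P z)‖ * ‖M‖ := ContinuousLinearMap.opNorm_comp_le _ _
  have hlow := sum_sq_chart_lower M P hP w w₀ z
  have hball : Fintype.card ι * ‖M‖ ^ 2 * ‖w - w₀‖ ^ 2 ≤ Fintype.card ι * ‖M‖ ^ 2 := by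
    have : ‖w - w₀‖ ^ 2 ≤ 1 := by nlinarith [norm_nonneg (w - w₀)]
    have h0 : 0 ≤ (Fintype.card ι : ℝ) * ‖M‖ ^ 2 := by positivity
    nlinarith
  have hgauss : exp (-(m / 8) * ∑ x, ((M w + P z) x - M w₀ x) ^ 2) ≤
      exp (m / 8 * (Fintype.card ι * ‖M‖ ^ 2)) * exp (-(m * p / 16) * ∑ i, z i ^ 2) := by
    rw [← exp_add]
    refine exp_le_exp.2 ?_
    nlinarith
  calc exp (-S (M w + P z)) * ‖(S' (M w + P z)).comp M‖
      ≤ exp (-S (M w + P z)) * (‖S' (M w + P z)‖ * ‖M‖) := mul_le_mul_of_nonneg_left hcomp (exp_pos _).le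
    _ = exp (-S (M w + P z)) * ‖S' (M w + P z)‖ * ‖M‖ := by ring
    _ ≤ K0 * exp (-(m / 8) * ∑ x, ((M w + P z) x - M w₀ x) ^ 2) * ‖M‖ :=
        mul_le_mul_of_nonneg_right hwe (norm_nonneg _)
    _ ≤ K0 * (exp (m / 8 * (Fintype.card ι * ‖M‖ ^ 2)) * exp (-(m * p / 16) * ∑ i, z i ^ 2)) * ‖M‖ :=
        mul_le_mul_of_nonneg_right (mul_le_mul_of_nonneg_left hgauss hK0nn) (norm_nonneg _)
    _ = K0 * ‖M‖ * exp (m / 8 * (Fintype.card ι * ‖M‖ ^ 2)) * exp (-(m * p / 16) * ∑ i, z i ^ 2) := by ring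

/-- **THE END: THE INTEGRATED EFFECTIVE ACTION IS DIFFERENTIABLE** (two-sided class, `m > 0`, `Λ ≥ 0`; chart `p·Σ z² ≤ Σ(P z)²`,
`p > 0`).  At EVERY base point `w₀`, `w ↦ −log ∫ e^{−S(M w + P z)} dz` has Fréchet derivative
`Z(w₀)⁻¹ • ∫ e^{−S(M w₀ + P z)} • (S′(M w₀ + P z))∘M dz` — the mean of the base derivative under the tilted fibre law; (28)'s
`hasFDerivAt_neg_log_fibreIntegral` with every letter discharged by §1–§4. [folklore] -/
theorem hasFDerivAt_neg_log_fibreIntegral_chart (hS : ∀ φ, HasFDerivAt S (S' φ) φ)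
    (hlo : ∀ φ ψ : ι → ℝ, S φ + S' φ (ψ - φ) + m / 2 * ∑ x, (ψ x - φ x) ^ 2 ≤ S ψ) (hm : 0 < m)
    (hup : ∀ φ ψ : ι → ℝ, S ψ ≤ S φ + S' φ (ψ - φ) + Λ / 2 * ∑ x, (ψ x - φ x) ^ 2) (hΛ : 0 ≤ Λ)
    (hP : ∀ z : σ → ℝ, p * ∑ i, z i ^ 2 ≤ ∑ x, P z x ^ 2) (hp : 0 < p) (w₀ : κ → ℝ) :
    HasFDerivAt (fun w : κ → ℝ => -log (∫ z : σ → ℝ, exp (-S (M w + P z))))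
      ((∫ z : σ → ℝ, exp (-S (M w₀ + P z)))⁻¹ •
        ∫ z : σ → ℝ, exp (-S (M w₀ + P z)) • (S' (M w₀ + P z)).comp M) w₀ := by
  have hcont : Continuous S := continuous_of_hasFDerivAt hS
  have hconv : ∀ φ ψ : ι → ℝ, S φ + S' φ (ψ - φ) ≤ S ψ := fun φ ψ => by
    have := hlo φ ψ
    have : 0 ≤ m / 2 * ∑ x, (ψ x - φ x) ^ 2 := mul_nonneg (by positivity) (Finset.sum_nonneg fun x _ => sq_nonneg _)
    linarith
  have hVc : ∀ w : κ → ℝ, Continuous fun z : σ → ℝ => S (M w + P z) := fun w =>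
    hcont.comp ((continuous_const (y := M w)).add P.continuous)
  have hVxc : ∀ w : κ → ℝ, Continuous fun z : σ → ℝ => (S' (M w + P z)).comp M := fun w =>
    continuous_gradient_comp_chart M P hS hconv w
  have hVd : ∀ (w : κ → ℝ) (z : σ → ℝ), HasFDerivAt (fun w' : κ → ℝ => S (M w' + P z)) ((S' (M w + P z)).comp M) w :=
    fun w z => (hS (M w + P z)).comp w (M.hasFDerivAt.add_const (P z))
  have key := hasFDerivAt_neg_log_fibreIntegral (μ := (volume : Measure (σ → ℝ)))
    (V := fun q : (κ → ℝ) × (σ → ℝ) => S (M q.1 + P q.2))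
    (Vx := fun q : (κ → ℝ) × (σ → ℝ) => (S' (M q.1 + P q.2)).comp M) (x₀ := w₀) (U := closedBall w₀ 1)
    (closedBall_mem_nhds w₀ one_pos)
    (fun w _ => (hVc w).aestronglyMeasurable)
    (integrable_exp_neg_chart M P hS hlo hm hP hp w₀)
    (hVxc w₀).aestronglyMeasurable
    (fun w _ z => hVd w z)
    (integrable_gaussian_pi (a := m * p / 16) (by positivity)
      (exp (-S (M w₀) + ‖S' (M w₀)‖ ^ 2 / m) * (‖S' (M w₀)‖ + Λ * Fintype.card ι + 8 * Λ / m) * ‖M‖ *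
        exp (m / 8 * (Fintype.card ι * ‖M‖ ^ 2))))
    (fun w hw z => by
      rw [mem_closedBall, dist_eq_norm] at hw
      exact chart_domination M P hlo hm hup hΛ hP w₀ hw z)
    (fibreIntegral_pos M P hS hlo hm hP hp w₀)
  exact key

/-- **THE WEIGHTED GRADIENT IS INTEGRABLE ALONG THE CHART** (two-sided class): `z ↦ e^{−S(M w + P z)} • (S′(M w + P z))∘M` is
Bochner integrable — the tilted mean in `hasFDerivAt_neg_log_fibreIntegral_chart` is a genuine integral, so
`(∫ e^{−S} • (S′∘M)) k = ∫ e^{−S}·S′(M k)` (`ContinuousLinearMap.integral_apply`). [folklore] -/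
theorem integrable_weighted_gradient_chart (hS : ∀ φ, HasFDerivAt S (S' φ) φ)
    (hlo : ∀ φ ψ : ι → ℝ, S φ + S' φ (ψ - φ) + m / 2 * ∑ x, (ψ x - φ x) ^ 2 ≤ S ψ) (hm : 0 < m)
    (hup : ∀ φ ψ : ι → ℝ, S ψ ≤ S φ + S' φ (ψ - φ) + Λ / 2 * ∑ x, (ψ x - φ x) ^ 2) (hΛ : 0 ≤ Λ)
    (hP : ∀ z : σ → ℝ, p * ∑ i, z i ^ 2 ≤ ∑ x, P z x ^ 2) (hp : 0 < p) (w : κ → ℝ) :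
    Integrable (fun z : σ → ℝ => exp (-S (M w + P z)) • (S' (M w + P z)).comp M) := by
  have hcont : Continuous S := continuous_of_hasFDerivAt hS
  have hconv : ∀ φ ψ : ι → ℝ, S φ + S' φ (ψ - φ) ≤ S ψ := fun φ ψ => by
    have := hlo φ ψ
    have : 0 ≤ m / 2 * ∑ x, (ψ x - φ x) ^ 2 := mul_nonneg (by positivity) (Finset.sum_nonneg fun x _ => sq_nonneg _)
    linarith
  have hVc : Continuous fun z : σ → ℝ => S (M w + P z) := hcont.comp ((continuous_const (y := M w)).add P.continuous)
  have hVxc : Continuous fun z : σ → ℝ => (S' (M w + P z)).comp M := continuous_gradient_comp_chart M P hS hconv w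
  have hmeas : AEStronglyMeasurable (fun z : σ → ℝ => exp (-S (M w + P z)) • (S' (M w + P z)).comp M) volume :=
    ((continuous_exp.comp hVc.neg).smul hVxc).aestronglyMeasurable
  refine Integrable.mono' (integrable_gaussian_pi (a := m * p / 16) (by positivity)
      (exp (-S (M w) + ‖S' (M w)‖ ^ 2 / m) * (‖S' (M w)‖ + Λ * Fintype.card ι + 8 * Λ / m) * ‖M‖ *
        exp (m / 8 * (Fintype.card ι * ‖M‖ ^ 2)))) hmeas (Eventually.of_forall fun z => ?_)
  rw [norm_smul, Real.norm_eq_abs, abs_of_pos (exp_pos _)]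
  exact chart_domination M P hlo hm hup hΛ hP w (by rw [sub_self, norm_zero]; exact zero_le_one) z

end Chart

/-! ## §2. Toy -/

/-- Toy (§1 `fibreIntegral_pos` with `S φ = Σ φ²` on one site, modulus `2`, no base (`κ` empty is allowed: take `κ = Unit`, `M = 0`)
and the identity chart `P = id`, `p = 1`): `0 < ∫ e^{−Σ(0 + z)²} dz`. -/
example : 0 < ∫ z : Unit → ℝ, exp (-(∑ x, ((0 : (Unit → ℝ) →L[ℝ] (Unit → ℝ)) (0 : Unit → ℝ) +
    (ContinuousLinearMap.id ℝ (Unit → ℝ)) z) x ^ 2)) := by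
  have hd : ∀ φ : Unit → ℝ, HasFDerivAt (fun φ : Unit → ℝ => ∑ x, φ x ^ 2)
      ((2 * φ ()) • ContinuousLinearMap.proj (R := ℝ) (φ := fun _ : Unit => ℝ) ()) φ := by
    intro φ
    have h1 : (fun φ : Unit → ℝ => ∑ x, φ x ^ 2) = fun φ => φ () ^ 2 := by funext φ; simp
    rw [h1]
    have h2 := ((ContinuousLinearMap.proj (R := ℝ) (φ := fun _ : Unit => ℝ) ()).hasFDerivAt (x := φ)).pow 2
    simpa using h2
  refine fibreIntegral_pos (S := fun φ : Unit → ℝ => ∑ x, φ x ^ 2) (m := 2) (p := 1) 0 (ContinuousLinearMap.id ℝ (Unit → ℝ))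
    hd (fun φ ψ => ?_) two_pos (fun z => by simp) one_pos 0
  simp only [Finset.univ_unique, PUnit.default_eq_unit, Finset.sum_singleton, smul_apply,
    ContinuousLinearMap.proj_apply, Pi.sub_apply, smul_eq_mul]
  nlinarith [sq_nonneg (ψ () - φ ())]

end Summit.QuantumFields.BalabanUV.T4Continuum.NE7b.SupConvexFibreIntegral

end
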